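import Summits.KontsevichZagierPeriods.KontsevichZagierPeriods.Theses.TerasomaMultiplication
import Summits.KontsevichZagierPeriods.KontsevichZagierPeriods.Theorems.MultiplicationThree.Negative.Pinned
import Summits.KontsevichZagierPeriods.KontsevichZagierPeriods.Theorems.MultiplicationThree.Negative.BolzaLever
import Literature.NumberTheory.Transcendental.KZMellinFibres
import Literature.NumberTheory.Transcendental.KZSubcalculusInvariants
import Literature.NumberTheory.Transcendental.KZDominatedFamilyRelations
import Literature.NumberTheory.Transcendental.KZLogCalculusProofs
import Literature.NumberTheory.Transcendental.KZSemialgebraicComplex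
import Mathlib.Analysis.SpecialFunctions.Pow.Deriv

/-!
# `MultiplicationThree` (stmt-KontsevichZagierPeriods-3598), line `bolza-involution-real-quotient`:
# stub S3 — the involution swaps the two cells of `Σ_box`

Stub `stub_upperCellToLowerCell` of the crux `MultiplicationThree` (route `TerasomaMultiplication`; lead skeleton
`Cruxes/MultiplicationThree/Lines/bolza-involution-real-quotient.lean`).

The sheared box `Σ_box = {0 < u, 0 < v < 1 − u}` (`u = x 0`, `v = x 1`) carries the density
`avg = u^{s−1}(ψ + ψ̄)/2`, `ψ = v^{−2/3}(1−v)^{−2/3}(1−u−v)^{−1/3}`,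
`ψ̄ = v^{−1/3}(1−v)^{−1/3}(1−u−v)^{−2/3}`. The cut `u = (1−v)²` splits `Σ_box` into the lower cell
`u < (1−v)²` and the upper cell `(1−v)² < u`. The birational involution
`ι(u,v) = (u, (1−u−v)/(1−v))` of `Σ_box` satisfies `1 − ι₁ = u/(1−v)`, `1 − u − ι₁ = uv/(1−v)`,
`det Dι = −u/(1−v)²`, `ι ∘ ι = id` on `Σ_box`; since `(1 − ι₁)² = u²/(1−v)²`, it swaps the two
cells, and the density is `ι`-invariant up to the Jacobian: `ψ(ιx)·|det Dι(x)| = ψ̄(x)` (the tree's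
identity `bolza_involution_density`) and its mirror `ψ̄(ιx)·|det Dι(x)| = ψ(x)` (same proof: cube
both sides), so `avg(ιx)·|det Dι(x)| = avg(x)`. Hence
`[upperCell, avg] − [lowerCell, avg]` is ONE instance of Kontsevich–Zagier's rule (2) (change of
variables along `ι` restricted to the upper cell: a `ℚ`-semialgebraic rational map, derivative
within the cell, injective, image = the lower cell, integrand relation with `|det|`).

Nothing is defined in this file: the cells, the map `ι` and its Jacobian matrix are written out.

References: M. Kontsevich, D. Zagier, *Periods* (2001), §1.2 rules (1), (2).
-/

noncomputable section

open Set MeasureTheory MvPolynomial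
open Literature.NumberTheory.Transcendental Literature.NumberTheory.Transcendental.KZ
open Literature.ModelTheory.ExponentialFields (IsSemialgebraic)

namespace Summit.KontsevichZagierPeriods.TerasomaMultiplication.MultiplicationThreeBolza

open Summit.KontsevichZagierPeriods.TerasomaMultiplication.MultiplicationThreeNegative

/-! ### The cells -/

/-- The upper cell lies in `Σ_box`. [folklore] -/
theorem s3_upperCell_subset :
    {x : Fin 2 → ℝ | 0 < x 0 ∧ 0 < x 1 ∧ x 1 < 1 - x 0 ∧ (1 - x 1) ^ 2 < x 0} ⊆
      {x : Fin 2 → ℝ | 0 < x 0 ∧ 0 < x 1 ∧ x 1 < 1 - x 0} :=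
  fun _ hx => ⟨hx.1, hx.2.1, hx.2.2.1⟩

/-- The lower cell lies in `Σ_box`. [folklore] -/
theorem s3_lowerCell_subset :
    {x : Fin 2 → ℝ | 0 < x 0 ∧ 0 < x 1 ∧ x 1 < 1 - x 0 ∧ x 0 < (1 - x 1) ^ 2} ⊆
      {x : Fin 2 → ℝ | 0 < x 0 ∧ 0 < x 1 ∧ x 1 < 1 - x 0} :=
  fun _ hx => ⟨hx.1, hx.2.1, hx.2.2.1⟩

/-- The upper cell is `ℚ`-semialgebraic (four strict polynomial inequalities). [folklore] -/
theorem s3_isSemialgebraic_upperCell :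
    IsSemialgebraic ℚ {x : Fin 2 → ℝ | 0 < x 0 ∧ 0 < x 1 ∧ x 1 < 1 - x 0 ∧ (1 - x 1) ^ 2 < x 0} := by
  convert isSemialgebraic_setOf_forall_aeval_pos
    (![X 0, X 1, 1 - X 0 - X 1, X 0 - (1 - X 1) ^ 2] : Fin 4 → MvPolynomial (Fin 2) ℚ) using 1
  ext x
  simp only [mem_setOf_eq, Fin.forall_fin_succ, Matrix.cons_val_zero, Matrix.cons_val_succ,
    map_sub, map_one, map_pow, MvPolynomial.aeval_X, IsEmpty.forall_iff, and_true]
  constructor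
  · rintro ⟨h0, h1, h2, h3⟩; exact ⟨h0, h1, by linarith, by linarith⟩
  · rintro ⟨h0, h1, h2, h3⟩; exact ⟨h0, h1, by linarith, by linarith⟩

/-! ### The involution `ι(u,v) = (u, (1−u−v)/(1−v))` -/

/-- Evaluation of a `2`-vector at `0`. [folklore] -/
theorem s3_vec2_apply_zero (a b : ℝ) : (![a, b] : Fin 2 → ℝ) 0 = a := rfl

/-- Evaluation of a `2`-vector at `1`. [folklore] -/
theorem s3_vec2_apply_one (a b : ℝ) : (![a, b] : Fin 2 → ℝ) 1 = b := rfl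

/-- `ι` is an involution of `Σ_box`: `ι (ι x) = x`. [folklore] -/
theorem s3_iota_iota {x : Fin 2 → ℝ} (hx : x ∈ {x : Fin 2 → ℝ | 0 < x 0 ∧ 0 < x 1 ∧ x 1 < 1 - x 0}) :
    (![(![x 0, (1 - x 0 - x 1) / (1 - x 1)] : Fin 2 → ℝ) 0,
        (1 - (![x 0, (1 - x 0 - x 1) / (1 - x 1)] : Fin 2 → ℝ) 0 -
            (![x 0, (1 - x 0 - x 1) / (1 - x 1)] : Fin 2 → ℝ) 1) /
          (1 - (![x 0, (1 - x 0 - x 1) / (1 - x 1)] : Fin 2 → ℝ) 1)] : Fin 2 → ℝ) = x := by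
  obtain ⟨h0, -, h2⟩ := hx
  have h1x : 1 - x 1 ≠ 0 := by linarith
  have h0x : x 0 ≠ 0 := h0.ne'
  have hu := (bolza_involution_algebra (x 0) (x 1) (by linarith)).1
  funext i
  fin_cases i
  · rfl
  · show (1 - x 0 - (1 - x 0 - x 1) / (1 - x 1)) / (1 - (1 - x 0 - x 1) / (1 - x 1)) = x 1
    rw [hu]
    field_simp
    ring

/-- `ι` maps `Σ_box` into itself. [folklore] -/
theorem s3_mapsTo_iota :
    MapsTo (fun x : Fin 2 → ℝ => (![x 0, (1 - x 0 - x 1) / (1 - x 1)] : Fin 2 → ℝ))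
      {x : Fin 2 → ℝ | 0 < x 0 ∧ 0 < x 1 ∧ x 1 < 1 - x 0}
      {x : Fin 2 → ℝ | 0 < x 0 ∧ 0 < x 1 ∧ x 1 < 1 - x 0} := by
  intro x hx
  obtain ⟨h0, h1, h2⟩ := hx
  have h1x : 0 < 1 - x 1 := by linarith
  refine ⟨h0, ?_, ?_⟩
  · show 0 < (1 - x 0 - x 1) / (1 - x 1)
    exact div_pos (by linarith) h1x
  · show (1 - x 0 - x 1) / (1 - x 1) < 1 - x 0
    rw [div_lt_iff₀ h1x]
    nlinarith

/-- `ι` maps the upper cell into the lower cell: `(1−v)² < u ⇒ ι₀ = u < (1 − ι₁)² = u²/(1−v)²`.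
[folklore] -/
theorem s3_mapsTo_iota_upper :
    MapsTo (fun x : Fin 2 → ℝ => (![x 0, (1 - x 0 - x 1) / (1 - x 1)] : Fin 2 → ℝ))
      {x : Fin 2 → ℝ | 0 < x 0 ∧ 0 < x 1 ∧ x 1 < 1 - x 0 ∧ (1 - x 1) ^ 2 < x 0}
      {x : Fin 2 → ℝ | 0 < x 0 ∧ 0 < x 1 ∧ x 1 < 1 - x 0 ∧ x 0 < (1 - x 1) ^ 2} := by
  intro x hx
  obtain ⟨hb0, hb1, hb2⟩ := s3_mapsTo_iota (s3_upperCell_subset hx)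
  obtain ⟨h0, h1, h2, h3⟩ := hx
  have h1x : 0 < 1 - x 1 := by linarith
  have hu := (bolza_involution_algebra (x 0) (x 1) (by linarith)).1
  refine ⟨hb0, hb1, hb2, ?_⟩
  show x 0 < (1 - (1 - x 0 - x 1) / (1 - x 1)) ^ 2
  rw [hu, div_pow, lt_div_iff₀ (by positivity)]
  nlinarith

/-- `ι` maps the lower cell into the upper cell: `u < (1−v)² ⇒ (1 − ι₁)² = u²/(1−v)² < u = ι₀`.
[folklore] -/
theorem s3_mapsTo_iota_lower :
    MapsTo (fun x : Fin 2 → ℝ => (![x 0, (1 - x 0 - x 1) / (1 - x 1)] : Fin 2 → ℝ))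
      {x : Fin 2 → ℝ | 0 < x 0 ∧ 0 < x 1 ∧ x 1 < 1 - x 0 ∧ x 0 < (1 - x 1) ^ 2}
      {x : Fin 2 → ℝ | 0 < x 0 ∧ 0 < x 1 ∧ x 1 < 1 - x 0 ∧ (1 - x 1) ^ 2 < x 0} := by
  intro x hx
  obtain ⟨hb0, hb1, hb2⟩ := s3_mapsTo_iota (s3_lowerCell_subset hx)
  obtain ⟨h0, h1, h2, h3⟩ := hx
  have h1x : 0 < 1 - x 1 := by linarith
  have hu := (bolza_involution_algebra (x 0) (x 1) (by linarith)).1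
  refine ⟨hb0, hb1, hb2, ?_⟩
  show (1 - (1 - x 0 - x 1) / (1 - x 1)) ^ 2 < x 0
  rw [hu, div_pow, div_lt_iff₀ (by positivity)]
  nlinarith

/-- `ι` is injective on the upper cell (it is its own left inverse). [folklore] -/
theorem s3_injOn_iota :
    InjOn (fun x : Fin 2 → ℝ => (![x 0, (1 - x 0 - x 1) / (1 - x 1)] : Fin 2 → ℝ))
      {x : Fin 2 → ℝ | 0 < x 0 ∧ 0 < x 1 ∧ x 1 < 1 - x 0 ∧ (1 - x 1) ^ 2 < x 0} :=
  (show LeftInvOn (fun x : Fin 2 → ℝ => (![x 0, (1 - x 0 - x 1) / (1 - x 1)] : Fin 2 → ℝ))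
      (fun x : Fin 2 → ℝ => (![x 0, (1 - x 0 - x 1) / (1 - x 1)] : Fin 2 → ℝ))
      {x : Fin 2 → ℝ | 0 < x 0 ∧ 0 < x 1 ∧ x 1 < 1 - x 0 ∧ (1 - x 1) ^ 2 < x 0} from
    fun _ hx => s3_iota_iota (s3_upperCell_subset hx)).injOn

/-- `ι` maps the upper cell ONTO the lower cell. [folklore] -/
theorem s3_image_iota :
    (fun x : Fin 2 → ℝ => (![x 0, (1 - x 0 - x 1) / (1 - x 1)] : Fin 2 → ℝ)) ''
        {x : Fin 2 → ℝ | 0 < x 0 ∧ 0 < x 1 ∧ x 1 < 1 - x 0 ∧ (1 - x 1) ^ 2 < x 0} =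
      {x : Fin 2 → ℝ | 0 < x 0 ∧ 0 < x 1 ∧ x 1 < 1 - x 0 ∧ x 0 < (1 - x 1) ^ 2} :=
  (s3_mapsTo_iota_upper.image_subset).antisymm fun y hy =>
    ⟨![y 0, (1 - y 0 - y 1) / (1 - y 1)], s3_mapsTo_iota_lower hy,
      s3_iota_iota (s3_lowerCell_subset hy)⟩

/-- `ι` is a `ℚ`-semialgebraic map on the upper cell (a rational map with non-vanishing
denominator). [folklore] -/
theorem s3_isSemialgebraicMapOn_iota :
    IsSemialgebraicMapOn ℚ {x : Fin 2 → ℝ | 0 < x 0 ∧ 0 < x 1 ∧ x 1 < 1 - x 0 ∧ (1 - x 1) ^ 2 < x 0}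
      (fun x : Fin 2 → ℝ => (![x 0, (1 - x 0 - x 1) / (1 - x 1)] : Fin 2 → ℝ)) := by
  refine IsSemialgebraicMapOn.of_forall s3_isSemialgebraic_upperCell
    (Fin.forall_fin_two.mpr ⟨?_, ?_⟩)
  · exact (isSemialgebraicFunOn_aeval s3_isSemialgebraic_upperCell (X 0)).congr fun x _ => by simp
  · have hn := isSemialgebraicFunOn_aeval s3_isSemialgebraic_upperCell
      (1 - X 0 - X 1 : MvPolynomial (Fin 2) ℚ)
    have hd := isSemialgebraicFunOn_aeval s3_isSemialgebraic_upperCell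
      (1 - X 1 : MvPolynomial (Fin 2) ℚ)
    refine (hn.div hd fun x hx => ?_).congr fun x _ => ?_
    · simp only [map_sub, map_one, MvPolynomial.aeval_X]
      obtain ⟨h0, -, h2, -⟩ := hx
      linarith
    · simp

/-- `ι` is differentiable off `v = 1`, with Jacobian matrix `[[1, 0], [−1/(1−v), −u/(1−v)²]]` and
`det Dι(u,v) = −u/(1−v)²`. [folklore] -/
theorem s3_hasFDerivAt_iota : ∃ D : (Fin 2 → ℝ) → (Fin 2 → ℝ) →L[ℝ] (Fin 2 → ℝ),
    ∀ x : Fin 2 → ℝ, x 1 ≠ 1 →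
      HasFDerivAt (fun x : Fin 2 → ℝ => (![x 0, (1 - x 0 - x 1) / (1 - x 1)] : Fin 2 → ℝ)) (D x) x ∧
        (D x).det = -(x 0) / (1 - x 1) ^ 2 := by
  refine ⟨fun x => LinearMap.toContinuousLinearMap
    (Matrix.toLin' !![(1:ℝ), 0; -1 / (1 - x 1), -(x 0) / (1 - x 1) ^ 2]), fun x hx => ⟨?_, ?_⟩⟩
  · have h1x : 1 - x 1 ≠ 0 := sub_ne_zero.mpr (Ne.symm hx)
    have h0 : HasFDerivAt (fun y : Fin 2 → ℝ => y 0)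
        (ContinuousLinearMap.proj (R := ℝ) (φ := fun _ : Fin 2 => ℝ) 0) x :=
      hasFDerivAt_apply 0 x
    have h1 : HasFDerivAt (fun y : Fin 2 → ℝ => y 1)
        (ContinuousLinearMap.proj (R := ℝ) (φ := fun _ : Fin 2 => ℝ) 1) x :=
      hasFDerivAt_apply 1 x
    beta_reduce
    rw [hasFDerivAt_pi']
    refine Fin.forall_fin_two.mpr ⟨?_, ?_⟩
    · show HasFDerivAt (fun y : Fin 2 → ℝ => y 0) _ x
      refine h0.congr_fderiv (ContinuousLinearMap.ext fun v => ?_)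
      simp [Matrix.toLin'_apply, dotProduct, Fin.sum_univ_two]
    · show HasFDerivAt (fun y : Fin 2 → ℝ => (1 - y 0 - y 1) / (1 - y 1)) _ x
      have hnum : HasFDerivAt (fun y : Fin 2 → ℝ => 1 - y 0 - y 1)
          (-(ContinuousLinearMap.proj (R := ℝ) (φ := fun _ : Fin 2 => ℝ) 0) -
            ContinuousLinearMap.proj (R := ℝ) (φ := fun _ : Fin 2 => ℝ) 1) x :=
        (h0.const_sub 1).sub h1
      have hden : HasFDerivAt (fun y : Fin 2 → ℝ => (1 - y 1)⁻¹)
          ((ContinuousLinearMap.smulRight (1 : ℝ →L[ℝ] ℝ) (-((1 - x 1) ^ 2)⁻¹)).comp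
            (-(ContinuousLinearMap.proj (R := ℝ) (φ := fun _ : Fin 2 => ℝ) 1))) x :=
        (hasFDerivAt_inv h1x).comp x (h1.const_sub 1)
      have hdiv : (fun y : Fin 2 → ℝ => (1 - y 0 - y 1) / (1 - y 1)) =
          fun y => (1 - y 0 - y 1) * (1 - y 1)⁻¹ := funext fun y => div_eq_mul_inv _ _
      rw [hdiv]
      refine (hnum.mul hden).congr_fderiv (ContinuousLinearMap.ext fun v => ?_)
      simp [Matrix.toLin'_apply, dotProduct, Fin.sum_univ_two]
      field_simp
      ring
  · change LinearMap.det
      (Matrix.toLin' !![(1:ℝ), 0; -1 / (1 - x 1), -(x 0) / (1 - x 1) ^ 2]) = _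
    rw [LinearMap.det_toLin', Matrix.det_fin_two]
    simp

/-! ### The Jacobian identities -/

/-- Mirror of `bolza_involution_density`: `ψ̄(ιx)·|det Dι(x)| = ψ(x)` on `0 < u`, `0 < v < 1 − u`.
Proof: cube both sides. [folklore] -/
theorem s3_involution_density_mirror {u v : ℝ} (hu : 0 < u) (hv : 0 < v) (huv : v < 1 - u) :
    ((1 - u - v) / (1 - v)) ^ (-(1:ℝ)/3) * (u / (1 - v)) ^ (-(1:ℝ)/3) *
        (u * v / (1 - v)) ^ (-(2:ℝ)/3) * (u / (1 - v) ^ 2) =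
      v ^ (-(2:ℝ)/3) * (1 - v) ^ (-(2:ℝ)/3) * (1 - u - v) ^ (-(1:ℝ)/3) := by
  have h1v : 0 < 1 - v := by linarith
  have hN : 0 < 1 - u - v := by linarith
  apply (Odd.strictMono_pow (R := ℝ) (n := 3) (by decide)).injective
  simp only
  rw [mul_pow, mul_pow, mul_pow, mul_pow, mul_pow,
    ← Real.rpow_mul_natCast (div_pos hN h1v).le, ← Real.rpow_mul_natCast (div_pos hu h1v).le,
    ← Real.rpow_mul_natCast (div_pos (mul_pos hu hv) h1v).le, ← Real.rpow_mul_natCast hv.le,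
    ← Real.rpow_mul_natCast h1v.le, ← Real.rpow_mul_natCast hN.le]
  norm_num
  simp only [Real.rpow_neg_one]
  field_simp

/-- The rule-(2) integrand relation `avg(x) = avg(ιx)·|det Dι(x)|` on `Σ_box`, written out with
`ι₀ = u`, `ι₁ = (1−u−v)/(1−v)`, `|det Dι| = u/(1−v)²`. [folklore] -/
theorem s3_avg_jacobian {s : ℚ} {u v : ℝ} (hu : 0 < u) (hv : 0 < v) (huv : v < 1 - u) :
    (u ^ ((s:ℝ) - 1) * (v ^ (-(2:ℝ)/3) * (1 - v) ^ (-(2:ℝ)/3) * (1 - u - v) ^ (-(1:ℝ)/3)) +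
        u ^ ((s:ℝ) - 1) * (v ^ (-(1:ℝ)/3) * (1 - v) ^ (-(1:ℝ)/3) * (1 - u - v) ^ (-(2:ℝ)/3))) / 2 =
      (u ^ ((s:ℝ) - 1) * (((1 - u - v) / (1 - v)) ^ (-(2:ℝ)/3) *
          (1 - (1 - u - v) / (1 - v)) ^ (-(2:ℝ)/3) * (1 - u - (1 - u - v) / (1 - v)) ^ (-(1:ℝ)/3)) +
        u ^ ((s:ℝ) - 1) * (((1 - u - v) / (1 - v)) ^ (-(1:ℝ)/3) *
          (1 - (1 - u - v) / (1 - v)) ^ (-(1:ℝ)/3) * (1 - u - (1 - u - v) / (1 - v)) ^ (-(2:ℝ)/3))) /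
        2 * (u / (1 - v) ^ 2) := by
  obtain ⟨e1, e2, -⟩ := bolza_involution_algebra u v (by linarith)
  rw [e1, e2, ← bolza_involution_density hu hv huv, ← s3_involution_density_mirror hu hv huv]
  ring

/-! ### The stub -/

/-- **Stub S3.** For representations `r = [upperCell, u^{s−1}(ψ+ψ̄)/2]` and
`ρ = [lowerCell, u^{s−1}(ψ+ψ̄)/2]`, `[r] − [ρ] ∈ changeOfVariablesRel` along the involution
`ι(u,v) = (u, (1−u−v)/(1−v))` restricted to the upper cell (rule (2) of the Kontsevich–Zagier
calculus: `ι` is a `ℚ`-semialgebraic injective rational map with derivative within the cell,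
`ι '' upperCell = lowerCell`, and `avg(ιx)·|det Dι(x)| = avg(x)`); hence `r ~ ρ`. [folklore] -/
theorem stub_upperCellToLowerCell :
    ∀ s : ℚ, 0 < s → ∀ (r ρ : Literature.NumberTheory.Transcendental.KZ.IntegralRep 2), r.domain = {x | 0 < x 0 ∧ 0 < x 1 ∧ x 1 < 1 - x 0 ∧ (1 - x 1) ^ 2 < x 0} → Set.EqOn r.integrand (fun x => ((x 0) ^ ((s:ℝ) - 1) * ((x 1) ^ (-(2:ℝ)/3) * (1 - x 1) ^ (-(2:ℝ)/3) * (1 - x 0 - x 1) ^ (-(1:ℝ)/3)) + (x 0) ^ ((s:ℝ) - 1) * ((x 1) ^ (-(1:ℝ)/3) * (1 - x 1) ^ (-(1:ℝ)/3) * (1 - x 0 - x 1) ^ (-(2:ℝ)/3))) / 2) r.domain → ρ.domain = {x | 0 < x 0 ∧ 0 < x 1 ∧ x 1 < 1 - x 0 ∧ x 0 < (1 - x 1) ^ 2} → Set.EqOn ρ.integrand (fun x => ((x 0) ^ ((s:ℝ) - 1) * ((x 1) ^ (-(2:ℝ)/3) * (1 - x 1) ^ (-(2:ℝ)/3) * (1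 - x 0 - x 1) ^ (-(1:ℝ)/3)) + (x 0) ^ ((s:ℝ) - 1) * ((x 1) ^ (-(1:ℝ)/3) * (1 - x 1) ^ (-(1:ℝ)/3) * (1 - x 0 - x 1) ^ (-(2:ℝ)/3))) / 2) ρ.domain → Literature.NumberTheory.Transcendental.KZ.Equivalent r ρ := by
  intro s _ r ρ hr hri hρ hρi
  obtain ⟨D, hD⟩ := s3_hasFDerivAt_iota
  refine changeOfVariablesRel_subset_relations
    ⟨2, r, ρ, fun x : Fin 2 → ℝ => (![x 0, (1 - x 0 - x 1) / (1 - x 1)] : Fin 2 → ℝ), D, ?_,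
      fun x hx => ?_, ?_, ?_, fun x hx => ?_, rfl⟩
  · rw [hr]; exact s3_isSemialgebraicMapOn_iota
  · rw [hr] at hx ⊢
    have hx1 : x 1 ≠ 1 := by obtain ⟨h0, -, h2, -⟩ := hx; linarith
    exact (hD x hx1).1.hasFDerivWithinAt
  · rw [hr]; exact s3_injOn_iota
  · rw [hρ, hr, s3_image_iota]
  · have hx' : x ∈ {x : Fin 2 → ℝ | 0 < x 0 ∧ 0 < x 1 ∧ x 1 < 1 - x 0 ∧ (1 - x 1) ^ 2 < x 0} :=
      hr ▸ hx
    obtain ⟨h0, h1, h2⟩ := s3_upperCell_subset hx'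
    have hx1 : x 1 ≠ 1 := by linarith
    have h1x : 0 < 1 - x 1 := by linarith
    have hmem : (![x 0, (1 - x 0 - x 1) / (1 - x 1)] : Fin 2 → ℝ) ∈ ρ.domain := by
      rw [hρ]; exact s3_mapsTo_iota_upper hx'
    have e3 : |(D x).det| = x 0 / (1 - x 1) ^ 2 := by
      rw [(hD x hx1).2, neg_div, abs_neg, abs_of_pos (div_pos h0 (pow_pos h1x 2))]
    beta_reduce
    rw [hri hx, hρi hmem, e3]
    beta_reduce
    rw [s3_vec2_apply_zero, s3_vec2_apply_one]
    exact s3_avg_jacobian h0 h1 h2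

end Summit.KontsevichZagierPeriods.TerasomaMultiplication.MultiplicationThreeBolza

end
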